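import Literature.AlgebraicGeometry.Frobenioids.ArithmeticRealificationCoordinates
import HarnessLib

/-!
# Frobenioids I, Cor. 5.4 at `C_{K/F}` (row C54-core-arith, sub-row (4), final data-level step): the
# coordinate squeeze in THE realification `Φ(L)^rlf` of the arithmetic divisor monoid

Mochizuki, *The geometry of Frobenioids I: the general theory*, Kyushu J. Math. **62** (2008) 293–400,
Cor. 5.4 p. 104 (1-uniqueness of `Ψ^rlf`), for THE realification of Prop. 5.3 of the arithmetic Frobenioid
`C_{K/F}` of Ex. 6.3 / Thm. 6.4 (i) p. 115 ("`(Φ^rlf)^gp(L) = ArithDiv_ℝ(L)`"). [cite: MochizukiFrdI2008, Cor. 5.4 p.104]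
[cite: MochizukiFrdI2008, Thm. 6.4 (i) p.115]

PROOF-ONLY (cell abc-iut, seat abc-iut-L1-d9; the last, purely arithmetic step of the hom-rigidity of
`C_{K/F}^un-tr → C_{K/F}^rlf` — L1-lead R120 (2): after the model-level reductions of seats abc-iut-L1-d8
(`Cor54RigidityLinearReduction/Transport`, cocycle `δ`) and abc-iut-w5-d048 (`Cor54RigidityModelLemmas`), the
discrepancy `δ = Div(ρ k) − Div(k) ∈ (Φ(L)^rlf)^gp` of an identity-base linear morphism satisfies
`c · δ^n ∈ Φ(L)^rlf` (EFFECTIVE) for one fixed `c ∈ Φ(L)^rlf` and ALL `n ∈ ℤ`; this file proves that such a `δ`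
is trivial).  Through seat abc-iut-L1-d2's coordinates `Θ : (Φ(L)^rlf)^gp ↪ ADiv_ℝ(L)`
(`ArithRlfCoord.exists_rlfGp_coordinates`: injective, effective ↦ coefficientwise `≥ 0`) the hypothesis reads
`Θ(c)_v + n · Θ(δ)_v ≥ 0` for all `n ∈ ℤ` at every place `v`, whence `Θ(δ) = 0` (archimedean property of `ℝ`)
and `δ = 1`:

* (private) `real_eq_zero_of_forall_int_nonneg` — `(∀ n : ℤ, 0 ≤ C + n x) → x = 0` in `ℝ`;
* **`ArithRlfCoord.rlfGp_eq_one_of_forall_zpow_effective`** — in `(Φ(L)^rlf)^gp`: if `c · δ^n` is (the class of)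
  an element of `Φ(L)^rlf` for every `n ∈ ℤ`, then `δ = 1`;
* `ArithRlfCoord.rlf_eq_of_forall_pow_mul_effective` — two-sided monoid form: `a, b ∈ Φ(L)^rlf` with
  `c · aⁿ = e_n · bⁿ` and `c · bⁿ = e'_n · aⁿ` (`e_n, e'_n ∈ Φ(L)^rlf`) for all `n ∈ ℕ` are equal;
* `ArithRlfCoord.exists_iota_eq_of_mul_iota_eq_iota` / `exists_iota_eq_of_of_mul_eq` — INTEGRALITY: `x · ι(b) = ι(a)`
  forces `x = ι(a − b)` (so linear morphisms with unit coordinate in `ι(Φ^birat)` are images).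
Nothing here is specific to the abc programme.
-/

noncomputable section

namespace Literature.AlgebraicGeometry.Frobenioids

namespace ArithRlfCoord

open Function NumberField Literature.IUT.LogVolume

/-- **Archimedean squeeze in `ℝ`**: if `C + n · x ≥ 0` for every integer `n`, then `x = 0` (private helper). [folklore] -/
private theorem real_eq_zero_of_forall_int_nonneg {C x : ℝ} (h : ∀ n : ℤ, 0 ≤ C + n * x) : x = 0 := by
  by_contra hx
  rcases lt_or_gt_of_ne hx with hlt | hgt
  · -- `x < 0`: take `n = ⌈C / (-x)⌉ + 1 > C / (-x)`, then `C + n x < 0`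
    obtain ⟨n, hn⟩ := exists_nat_gt (C / (-x))
    have hnx : C < n * (-x) := by rwa [div_lt_iff₀ (neg_pos.mpr hlt)] at hn
    have := h n
    push_cast at this
    linarith
  · -- `x > 0`: take `n = -(⌈C / x⌉ + 1)`
    obtain ⟨n, hn⟩ := exists_nat_gt (C / x)
    have hnx : C < n * x := by rwa [div_lt_iff₀ hgt] at hn
    have := h (-(n : ℤ))
    push_cast at this
    linarith

variable {L : Type} [Field L] [NumberField L] (hM : IsPerfFactorial (Multiplicative (EffArithDivisor L)))

/-- **The squeeze in `(Φ(L)^rlf)^gp`.**  If `δ ∈ (Φ(L)^rlf)^gp` and `c ∈ Φ(L)^rlf` are such that `c · δ^n` is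
effective (the class of an element of `Φ(L)^rlf`) for EVERY `n ∈ ℤ`, then `δ = 1`: in the coordinates
`Θ : (Φ(L)^rlf)^gp ↪ ADiv_ℝ(L)` (seat abc-iut-L1-d2) effectivity is coefficientwise non-negativity, so
`Θ(c)_v + n·Θ(δ)_v ≥ 0` for all `n`, `Θ(δ) = 0`, and `Θ` is injective. [cite: MochizukiFrdI2008, Cor. 5.4 p.104] -/
theorem rlfGp_eq_one_of_forall_zpow_effective (δ : Algebra.GrothendieckGroup hM.Rlf) (c : hM.Rlf)
    (h : ∀ n : ℤ, ∃ e : hM.Rlf, Algebra.GrothendieckGroup.of c * δ ^ n = Algebra.GrothendieckGroup.of e) :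
    δ = 1 := by
  obtain ⟨Θ, hinj, -, hnonneg, -⟩ := exists_rlfGp_coordinates hM
  apply hinj
  rw [map_one]
  -- coefficientwise
  apply Multiplicative.toAdd.injective
  rw [toAdd_one]
  refine Finsupp.ext fun p => ?_
  rw [Finsupp.zero_apply]
  refine real_eq_zero_of_forall_int_nonneg (C := Multiplicative.toAdd (Θ (Algebra.GrothendieckGroup.of c)) p)
    fun n => ?_
  obtain ⟨e, he⟩ := h n
  have hcoef := congrArg (fun y => Multiplicative.toAdd (Θ y) p) he
  simp only [map_mul, map_zpow, toAdd_mul, toAdd_zpow, Finsupp.add_apply, Finsupp.smul_apply,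
    zsmul_eq_mul] at hcoef
  rw [hcoef]
  exact hnonneg e p

/-- **Two-sided monoid form of the squeeze** (the shape in which the model-Frobenioid bookkeeping delivers it:
no groupification needed by the caller): if `a, b, c ∈ Φ(L)^rlf` satisfy `c · aⁿ = e_n · bⁿ` and
`c · bⁿ = e'_n · aⁿ` with `e_n, e'_n ∈ Φ(L)^rlf` for every `n ∈ ℕ`, then `a = b`.
[cite: MochizukiFrdI2008, Cor. 5.4 p.104] -/
theorem rlf_eq_of_forall_pow_mul_effective (a b c : hM.Rlf)
    (h₁ : ∀ n : ℕ, ∃ e : hM.Rlf, c * a ^ n = e * b ^ n) (h₂ : ∀ n : ℕ, ∃ e : hM.Rlf, c * b ^ n = e * a ^ n) :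
    a = b := by
  haveI : IsCancelMul hM.Rlf := IsPerfFactorial.Rlf.isCancelMul hM
  -- `δ := [a] [b]⁻¹`
  have key : Algebra.GrothendieckGroup.of a * (Algebra.GrothendieckGroup.of b)⁻¹ =
      (1 : Algebra.GrothendieckGroup hM.Rlf) := by
    refine rlfGp_eq_one_of_forall_zpow_effective hM _ c fun n => ?_
    rcases Int.eq_nat_or_neg n with ⟨m, rfl | rfl⟩
    · obtain ⟨e, he⟩ := h₁ m
      refine ⟨e, ?_⟩
      have := congrArg (Algebra.GrothendieckGroup.of (M := hM.Rlf)) he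
      rw [map_mul, map_pow, map_mul, map_pow] at this
      rw [zpow_natCast, mul_pow, inv_pow, ← mul_assoc, this, mul_inv_cancel_right]
    · obtain ⟨e, he⟩ := h₂ m
      refine ⟨e, ?_⟩
      have := congrArg (Algebra.GrothendieckGroup.of (M := hM.Rlf)) he
      rw [map_mul, map_pow, map_mul, map_pow] at this
      rw [zpow_neg, zpow_natCast, mul_pow, inv_pow, mul_inv_rev, inv_inv, ← mul_assoc, this,
        mul_inv_cancel_right]
  have hab : Algebra.GrothendieckGroup.of (M := hM.Rlf) a = Algebra.GrothendieckGroup.of b := by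
    rw [← mul_inv_eq_one, key]
  exact Algebra.GrothendieckGroup.of_injective hab

/-! ### Integrality: an element of `Φ(L)^rlf` which differs from `ι(Φ(L))` by `ι(Φ(L))` lies in `ι(Φ(L))` -/

/-- **Integrality in `Φ(L)^rlf`.**  If `x ∈ Φ(L)^rlf` satisfies `x · ι(b) = ι(a)` for effective arithmetic
divisors `a, b` (i.e. the class of `x` in `(Φ(L)^rlf)^gp` lies in `ι^gp(Φ(L)^gp)`), then `b ≤ a` and `x = ι(a − b)`:
in the coordinates `Θ` the coefficients of `x` are `a_v − b_v ≥ 0`, integers at the finite places — so the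
identity-base linear morphisms of `C_{K/F}^rlf` between image objects with unit coordinate in `ι(Φ^birat)` ARE
images of morphisms of `C_{K/F}^un-tr` (used with (c2) of the divisor cocycle). [cite: MochizukiFrdI2008, Thm. 6.4 (i) p.115] -/
theorem exists_iota_eq_of_mul_iota_eq_iota (x : hM.Rlf) (a b : EffArithDivisor L)
    (hx : x * hM.toRealification (Perfection.of _ (Multiplicative.ofAdd b)) =
      hM.toRealification (Perfection.of _ (Multiplicative.ofAdd a))) :
    ∃ E : EffArithDivisor L, E + b = a ∧ hM.toRealification (Perfection.of _ (Multiplicative.ofAdd E)) = x := by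
  haveI : IsCancelMul hM.Rlf := IsPerfFactorial.Rlf.isCancelMul hM
  obtain ⟨Θ, -, hΘι, hnonneg, -⟩ := exists_rlfGp_coordinates hM
  -- the coefficients of `x` are those of `a − b`, and they are `≥ 0`
  have hcoef : ∀ p : Place L,
      Multiplicative.toAdd (Θ (Algebra.GrothendieckGroup.of x)) p +
          ADivisor.ofArithDivisor L (EffArithDivisor.toArithDivisor L b) p =
        ADivisor.ofArithDivisor L (EffArithDivisor.toArithDivisor L a) p := by
    intro p
    have h := congrArg (fun y => Multiplicative.toAdd (Θ (Algebra.GrothendieckGroup.of y)) p) hx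
    simp only [map_mul, toAdd_mul, Finsupp.add_apply, hΘι, toAdd_ofAdd] at h
    exact h
  have hle₁ : ∀ v : FinitePlace L, b.1 v ≤ a.1 v := by
    intro v
    have h := hcoef (Sum.inr v.maximalIdeal)
    simp only [ADivisor.ofArithDivisor_apply_inr, FinitePlace.mk_maximalIdeal, EffArithDivisor.toArithDivisor_fst,
      Int.cast_natCast] at h
    have h0 := hnonneg x (Sum.inr v.maximalIdeal)
    exact_mod_cast (by linarith : (b.1 v : ℝ) ≤ a.1 v)
  have hle₂ : ∀ w : InfinitePlace L, b.2 w ≤ a.2 w := by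
    intro w
    have h := hcoef (Sum.inl w)
    simp only [ADivisor.ofArithDivisor_apply_inl, EffArithDivisor.toArithDivisor_snd] at h
    have h0 := hnonneg x (Sum.inl w)
    have hm : (0 : ℝ) < w.mult := by exact_mod_cast InfinitePlace.mult_pos
    have : (w.mult : ℝ) * (b.2 w : ℝ) ≤ w.mult * (a.2 w : ℝ) := by linarith
    exact_mod_cast le_of_mul_le_mul_left this hm
  -- `E := a − b` (truncated subtraction, exact by the inequalities)
  refine ⟨(a.1 - b.1, fun w => a.2 w - b.2 w), ?_, ?_⟩
  · refine Prod.ext (Finsupp.ext fun v => ?_) (funext fun w => ?_)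
    · show (a.1 - b.1) v + b.1 v = a.1 v
      rw [Finsupp.tsub_apply, tsub_add_cancel_of_le (hle₁ v)]
    · show a.2 w - b.2 w + b.2 w = a.2 w
      rw [tsub_add_cancel_of_le (hle₂ w)]
  · -- `ι(E) · ι(b) = ι(E + b) = ι(a) = x · ι(b)`, cancel `ι(b)`
    have hE : ((a.1 - b.1, fun w => a.2 w - b.2 w) : EffArithDivisor L) + b = a := by
      refine Prod.ext (Finsupp.ext fun v => ?_) (funext fun w => ?_)
      · show (a.1 - b.1) v + b.1 v = a.1 v
        rw [Finsupp.tsub_apply, tsub_add_cancel_of_le (hle₁ v)]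
      · show a.2 w - b.2 w + b.2 w = a.2 w
        rw [tsub_add_cancel_of_le (hle₂ w)]
    apply mul_right_cancel (b := hM.toRealification (Perfection.of _ (Multiplicative.ofAdd b)))
    rw [hx, ← map_mul, ← map_mul, ← ofAdd_add, hE]

/-- **Corollary (class form).**  `x ∈ Φ(L)^rlf` with `[x] · ι^gp[b] = ι^gp[a]` in `(Φ(L)^rlf)^gp` is `ι(a − b)`.
[cite: MochizukiFrdI2008, Thm. 6.4 (i) p.115] -/
theorem exists_iota_eq_of_of_mul_eq (x : hM.Rlf) (a b : EffArithDivisor L)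
    (hx : Algebra.GrothendieckGroup.of x *
        Algebra.GrothendieckGroup.of (hM.toRealification (Perfection.of _ (Multiplicative.ofAdd b))) =
      Algebra.GrothendieckGroup.of (hM.toRealification (Perfection.of _ (Multiplicative.ofAdd a)))) :
    ∃ E : EffArithDivisor L, E + b = a ∧ hM.toRealification (Perfection.of _ (Multiplicative.ofAdd E)) = x := by
  haveI : IsCancelMul hM.Rlf := IsPerfFactorial.Rlf.isCancelMul hM
  refine exists_iota_eq_of_mul_iota_eq_iota hM x a b (Algebra.GrothendieckGroup.of_injective ?_)
  rw [map_mul]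
  exact hx

end ArithRlfCoord

end Literature.AlgebraicGeometry.Frobenioids

end
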